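import Literature.NumberTheory.Rogawski1990.CohomologicalSpectrumInnerForm
import Literature.NumberTheory.Automorphic.DiscreteAutomorphicRepArchModuleCM
import Literature.RepresentationTheory.BorelWallach2000.UpqHodgeBigrading
import HarnessLib

/-!
# Archimedean rigidity of the `H¹`-cohomological discrete spectrum of the anisotropic inner forms `U(H)` of `U(3)` under a common finite
# component (letter β of the P3 E2′ dossier): the archimedean constituents at `ι` are `(𝔤, K)`-equivalent

Topic `NumberTheory/Rogawski1990`; namespace `Literature.NumberTheory.Rogawski1990`.  STATEMENT-ONLY: ONE closed named fact `def … : Prop` (no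
`sorry`, no instance, no notation); imports = tree (★ `CohomologicalSpectrumInnerForm` for the letter frame and `HasFinComponent`, ★ D4 CM companion
`DiscreteAutomorphicRepArchModuleCM` for `P.archModuleCM ∕ archRepKCM ∕ archRepLieCM`, ★ `BorelWallach2000.UpqHodgeBigrading` for the degree-one type
classes `upqTypeClasses`).  Cell hodgecm-mathlib FLOOR 0, crux H413: this is the statement β of F0P3-p03 (g3)'s dossier `F0/P3/p03/E2PRIME-RUNG2.md` §2,
ENDORSED by F0P3-plan (g2) 2026-08-31T01:15:56Z as THE rung-2 statement under the rung-1 line's `stub_E2p` (`Cruxes/H413/Lines/F0_U3LettersRung1.lean`), and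
it is consumed BY NAME (token-identical binder) by ★ `Summit.….F0P3HodgeTypeRigidOfArchRigid.hodgeTypeRigid_of_cohArchComponentRigid` (p799957), which derives the
letter E2′ `hodgeTypeRigid` from it + F1a + the value maps of cotangent forms.

SETTING = that of the sibling letters `innerFormMultiplicityLeOne` ∕ `cohFinComponentUnique_hol` ∕ `hodgeTypeRigid`: `L` CM with `[L⁺:ℚ] ≥ 2`, `ι : L →+* ℂ`,
`H ∈ M₃(L)` with a frame `T` (`Tᴴ·ι(H)·T = diag(1,1,−1)`), `τ(H)` positive definite at the complex places `≠` that of `ι` (so `G′ = U(H)` is the inner form of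
[Rogawski1990] Ch. 14 with `D = M₃(E)`, `S = ∅`, `S₀ = ` the `[L⁺:ℚ]−1 ≥ 1` compact real places), `μ` an automorphic measure, `P`, `P′` DISCRETE automorphic
representations (★ `DiscreteAutomorphicRep`) with a COMMON irreducible smooth finite component `σ` (★ `HasFinComponent`), and — the archimedean data, in the
currency of ★ D4 ∕ letter F1a `DiscreteAutomorphicRep.ArchIsotypy` — IRREDUCIBLE `(𝔤, K)`-modules `M`, `M′` of `U(2,1)_{Fin 2 ⊕ Fin 1}` receiving NON-ZERO
`(𝔤, K)`-maps from the archimedean modules `P.archModuleCM ι T hT`, `P′.archModuleCM ι T hT` (by F1a these are the Harish-Chandra modules of the archimedean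
components `P_ι`, `P′_ι`), both `H¹`-COHOMOLOGICAL: `upqTypeClasses … 1 δ ≠ ⊥` for some types `δ, δ′ ∈ {±1}` (★ `BorelWallach2000.upqTypeClasses`, the token of
the engine's T6c).  CONCLUSION: `M ≃ M′` (`AreGKEquivalent`).

THE READING (class **U**; every step located, [Rogawski1990] held scan, printed page ≈ chunk + 6):
(1) an irreducible unitary representation of `U(2,1)` with `H¹(𝔤, K; ·) ≠ 0` is `J⁺_φ` or `J⁻_φ`, `φ = φ(1,0,−1)` [Prop. 15.2.1 (b), p. 250; BorelWallach VI 4.11];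
(2) `J^±_φ = πⁿ(ξ_v)` for the one-dimensional `ξ_v = ξ(b,a,c)` resp. `ξ(a,c,b)` of `H_v` [§12.3 p. 175 «πⁿ(ξ) = J⁺_φ if ξ = ξ(b,a,c), J⁻_φ if ξ = ξ(a,c,b)»], and a
discrete `π` of `G′` with `π_v = J^±_φ` at a place `v ∈ S′_∞` lies in an A-packet `Π′(ξ)`, `ξ` a one-dimensional automorphic representation of `H` [Thm. 13.3.6 (c)
p. 201; for the inner form §15.3 ¶1 p. 250 «by Theorem 13.3.6 (c) and the results of §14.4»; CM case p. 251], membership meaning `t(π) = t(Π(ξ))` and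
`π_v ∈ Π′(ξ_v)` for all `v` [§14.6, set-up of Thm. 14.6.4, p. 244; the e.v.p. comparison rests on (14.6.1) = Thm. 14.6.1];
(3) a common irreducible smooth finite component gives `P_f ≅ σ ≅ P′_f` [FlathCorvallis1979 Thm. 3–4; BorelJacquetCorvallis1979 §4.6], hence `t(P) = t(P′)`;
(4) `t(P) = t(Π(ξ))`, `t(P′) = t(Π(ξ′))`, `t(P) = t(P′)` ⇒ `Π(ξ) = Π(ξ′)` [Thm. 13.3.5 p. 201] ⇒ `ξ = ξ′` [Thm. 14.6.4 proof l. 1, p. 244 «there exists a UNIQUE ξ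
such that the e.v.p.'s t(Π′) and t(Π(ξ)) coincide»; Prop. 13.2.2 (d) p. 200];
(5) `P_ι, P′_ι ∈ Π(ξ_ι) = {πⁿ(ξ_ι), πˢ(ξ_ι)}` and the square-integrable member `πˢ(ξ_ι) ∈ {D^±_φ}` has no `H¹` [Prop. 15.2.1 (a)], so `P_ι ≅ πⁿ(ξ_ι) ≅ P′_ι`, i.e.
their Harish-Chandra modules are equivalent [HarishChandra1953 Thm. 8 = GetzHahn2024 Thm. 4.4.4 for the converse direction, not needed].
NOT used: the multiplicity ∕ parity formula of Thm. 14.6.4, Prop. 14.6.2 (stable packets), Thm. 14.6.5 (endoscopic packets), [Rogawski1992].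

HONEST SCOPE.  (i) Same types (`δ = δ′`): the conclusion is what the engine's T6c gives in-house (★ `F0P3ArchValueMapEquivalence` ∕ ★
`F0P3CommonArchTypeOfValueMaps`, given F1a) — no printed content is needed there; opposite types: the content is steps (2)–(5) = exactly the part of
[Rogawski1990] that the archimedean engine T6 and the generic letters F1a ∕ F1b ∕ F2 do not touch (the conclusion then contradicts ★
`hol_antihol_inequivalent_of_irreducible`, which is how E2′ follows).  (ii) Junk models (each hypothesis block is load-bearing): without the common `σ` the
statement is false (`P` hol-type in `Π′(ξ)`, `P′ := conj P` antihol-type with finite part `σ̄`: `P_ι = J⁺ ≇ J⁻ = P′_ι`); without the cohomology hypotheses it is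
false (a STABLE cuspidal packet `Π′ ∈ Π_s(G′)` with `ι`-component a regular discrete-series L-packet `{D_φ, D⁺_φ, D⁻_φ}` has `m = 1` for all members, Prop. 14.6.2,
so two discrete `P ≠ P′` with `P_f ≅ P′_f` and inequivalent `P_ι`, `P′_ι` occur); without irreducibility of `M`, `M′` or non-vanishing of the maps it is false
(take `M ⊕ M` or the zero map).  (iii) Nominally β is as deep as E2′ (A-packets, e.v.p.-rigidity); its gain is the currency: purely representation-theoretic, no
cotangent forms or Hodge types — the Hodge dictionary half of E2′ is in-house (B1′ + ★ S2 ∕ J2 + ★ p799957).  HC_CM is proved only modulo the printed citations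
until rung 0 closes; this file is one of them (net debt: a SWAP E2′ → β at `stub_E2p` once the fold lands).

## References
* [Rogawski1990] J. Rogawski, *Automorphic representations of unitary groups in three variables*, Ann. of Math. Stud. 123 (1990): §12.3 p. 175 (chunk p0169
  L9–12), Thm. 13.3.5 and Thm. 13.3.6 (c) p. 201 (p0195 L16, L24), Prop. 13.2.2 (d) p. 200 (p0194), §14.6: Thm. 14.6.1 p. 241 (p0235), set-up of Thm. 14.6.4 and
  its proof l. 1 p. 244 (p0238 L7–11), Prop. 14.6.2 p. 242 (p0236), Prop. 15.2.1 (a)(b) and §15.3 ¶1 p. 250 (p0244), p. 251 L1 (p0245; CM case of 13.3.6 (c)).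
* [FlathCorvallis1979] D. Flath, *Decomposition of representations into tensor products*, PSPM 33.1 (1979), Thm. 3 and Thm. 4.
* [BorelJacquetCorvallis1979] A. Borel, H. Jacquet, *Automorphic forms and automorphic representations*, PSPM 33.1 (1979), §4.6.
* [BorelWallach2000] A. Borel, N. Wallach, 2nd ed. (2000), VI Thm. 4.11 (`H¹`-cohomological unitary representations of `U(2,1)`).
* [GetzHahn2024] J. Getz, H. Hahn, GTM 300 (2024), Thm. 4.4.4 p. 84, Thm. 6.5.2 p. 121 (infinitesimal vs unitary equivalence; not load-bearing here).
-/

-- Mathlib idiom (Mathlib/Algebra/Lie/OfAssociative.lean; as in ★ `GKModules`, ★ D4, ★ F1a, ★ `UpqHodgeBigrading`): the commutator bracket on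
-- `Module.End ℂ M`, needed to MENTION `(uFormGroup (Fin 2) (Fin 1)).lie →ₗ⁅ℝ⁆ Module.End ℂ M`.
attribute [local instance 100] LieRing.ofAssociativeRing

noncomputable section

open NumberField MeasureTheory
open scoped Matrix ComplexOrder

namespace Literature.NumberTheory.Rogawski1990

open Literature.NumberTheory.Automorphic Literature.NumberTheory.Automorphic.UnitaryGroup
open Literature.NumberTheory.Automorphic.UnitaryGroup.CotangentForms
open Literature.RepresentationTheory.BorelWallach2000
open Literature.RepresentationTheory.KonnoKonno2007

/-- **U** (β, E2′-arch) **Archimedean rigidity under a common finite component.**  For `L`, `ι`, `H`, `T`, `μ` as in `hodgeTypeRigid` (CM, `[L⁺:ℚ] ≥ 2`,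
signature `(2,1)` at `ι`, definite at the other complex places), an irreducible smooth `σ` of `U(H)(𝔸_{L⁺,f})` and two DISCRETE automorphic representations
`P`, `P′` of `U(H)` in both of which `σ` occurs (`HasFinComponent`): any irreducible `(𝔤, K)`-modules `M`, `M′` of `U(2,1)` receiving NON-ZERO `(𝔤, K)`-maps from
the archimedean modules `P.archModuleCM ι T hT`, `P′.archModuleCM ι T hT` (the Harish-Chandra modules of `P_ι`, `P′_ι` up to isotypy) and both
`H¹`-cohomological (`upqTypeClasses … 1 δ ≠ ⊥`, `upqTypeClasses … 1 δ′ ≠ ⊥`, `δ, δ′ ∈ {±1}`) are `(𝔤, K)`-EQUIVALENT.  READING: `H¹ ≠ 0` ⇒ `P_ι, P′_ι ∈ {J⁺_φ, J⁻_φ}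
= {πⁿ(ξ_ι)}` [Prop. 15.2.1 (b); §12.3 p. 175] ⇒ `P ∈ Π′(ξ)`, `P′ ∈ Π′(ξ′)` for one-dimensional `ξ, ξ′` [Thm. 13.3.6 (c) + §15.3 ¶1, CM case p. 251]; common
`σ` ⇒ `t(P) = t(P′)` [Flath Thm. 3–4; Borel–Jacquet §4.6] ⇒ `Π(ξ) = Π(ξ′)` [Thm. 13.3.5] ⇒ `ξ = ξ′` [Thm. 14.6.4 proof l. 1: unique `ξ`] ⇒ `P_ι ≅ πⁿ(ξ_ι) ≅ P′_ι`
[Prop. 15.2.1 (a): `πˢ(ξ_ι)` has no `H¹`].  Same-type case: in-house by T6c (no print needed); opposite-type case: the Rogawski content of E2′.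
[cite: Rogawski1990, Thm. 13.3.6 (c) and Thm. 13.3.5 (p. 201); §15.3 ¶1 and Prop. 15.2.1 (a)(b) (p. 250); §12.3 (p. 175); §14.6 Thm. 14.6.4, set-up and proof l. 1 (p. 244); Thm. 14.6.1 (p. 241)]
[cite: FlathCorvallis1979, Thm. 3 and Thm. 4] [cite: BorelJacquetCorvallis1979, §4.6] [cite: BorelWallach2000, VI Thm. 4.11] -/
def cohArchComponentRigid : Prop :=
  ∀ (L : Type) [Field L] [NumberField L] [IsCMField L] (ι : L →+* ℂ) (H : Matrix (Fin 3) (Fin 3) L) (T : GL (Fin 3) ℂ)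
    (hT : (T : Matrix (Fin 3) (Fin 3) ℂ)ᴴ * H.map ι * (T : Matrix (Fin 3) (Fin 3) ℂ) = Literature.Geometry.ComplexHyperbolic.BallModel.J),
    (∀ τ' : L →+* ℂ, InfinitePlace.mk τ' ≠ InfinitePlace.mk ι → (H.map τ').PosDef) →
    2 ≤ Module.finrank ℚ ↥(maximalRealSubfield L) →
    ∀ (μ : Measure (adelicGroupData (↥(maximalRealSubfield L)) L (IsCMField.complexConj L) 3 H).automorphicQuotient)
      [(adelicGroupData (↥(maximalRealSubfield L)) L (IsCMField.complexConj L) 3 H).IsAutomorphicMeasure μ]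
      (W : Type) [AddCommGroup W] [Module ℂ W]
      (σ : Representation ℂ (finAdelic (↥(maximalRealSubfield L)) L (IsCMField.complexConj L) 3 H) W),
      σ.IsIrreducible → σ.IsSmooth →
    ∀ (P P' : DiscreteAutomorphicRep (adelicGroupData (↥(maximalRealSubfield L)) L (IsCMField.complexConj L) 3 H) μ),
      P.HasFinComponent σ → P'.HasFinComponent σ →
    ∀ (M : Type) [AddCommGroup M] [Module ℂ M] (σK : Representation ℂ (uFormGroup (Fin 2) (Fin 1)).maximalCompact M)
      (σ𝔤 : (uFormGroup (Fin 2) (Fin 1)).lie →ₗ⁅ℝ⁆ Module.End ℂ M) (hM : IsGKModule (uFormGroup (Fin 2) (Fin 1)) σK σ𝔤),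
      IsIrreducibleGK σK σ𝔤 →
      (∃ T₁ : P.archModuleCM ι T hT →ₗ[ℂ] M,
        (∀ (k : (uFormGroup (Fin 2) (Fin 1)).maximalCompact) (w : P.archModuleCM ι T hT),
            T₁ (P.archRepKCM ι T hT k w) = σK k (T₁ w)) ∧
          (∀ (X : (uFormGroup (Fin 2) (Fin 1)).lie) (w : P.archModuleCM ι T hT),
            T₁ (P.archRepLieCM ι T hT X w) = σ𝔤 X (T₁ w)) ∧ T₁ ≠ 0) →
    ∀ (M' : Type) [AddCommGroup M'] [Module ℂ M'] (σK' : Representation ℂ (uFormGroup (Fin 2) (Fin 1)).maximalCompact M')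
      (σ𝔤' : (uFormGroup (Fin 2) (Fin 1)).lie →ₗ⁅ℝ⁆ Module.End ℂ M') (hM' : IsGKModule (uFormGroup (Fin 2) (Fin 1)) σK' σ𝔤'),
      IsIrreducibleGK σK' σ𝔤' →
      (∃ T₂ : P'.archModuleCM ι T hT →ₗ[ℂ] M',
        (∀ (k : (uFormGroup (Fin 2) (Fin 1)).maximalCompact) (w : P'.archModuleCM ι T hT),
            T₂ (P'.archRepKCM ι T hT k w) = σK' k (T₂ w)) ∧
          (∀ (X : (uFormGroup (Fin 2) (Fin 1)).lie) (w : P'.archModuleCM ι T hT),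
            T₂ (P'.archRepLieCM ι T hT X w) = σ𝔤' X (T₂ w)) ∧ T₂ ≠ 0) →
    ∀ (δ δ' : ℤ), (δ = 1 ∨ δ = -1) → (δ' = 1 ∨ δ' = -1) →
      upqTypeClasses σK σ𝔤 hM.ad_compat 1 δ ≠ ⊥ → upqTypeClasses σK' σ𝔤' hM'.ad_compat 1 δ' ≠ ⊥ →
      AreGKEquivalent σK σ𝔤 σK' σ𝔤'


end Literature.NumberTheory.Rogawski1990

end
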